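import Mathlib.Algebra.Polynomial.Eval.Defs
import Summits.PneNP.PneNP.Theorems.SymmetryBudgetWindowCanoniserGatesDefs
import Summits.PneNP.PneNP.Theorems.SymmetryBudgetWindowCanoniserLabelCount

/-!
# Window canoniser, II′: the gate type has polynomially many elements

Route `PneNP/SymmetryBudget`, dichotomy `WindowBarrier` (stmt-PneNP-2145) / `NoHiddenOrder` (stmt-PneNP-14781);
companion of `…WindowCanoniserNodesDefs.lean`.  Crude but explicit counting: `|Prm r n| ≤ 2^n (4 s^5)^12`
(`s = r+n+2`), `|Atom| ≤ 64 · 2^{(2K+4)n} (4 s^5)^12` (flatness of the labels, `…LabelCount.lean`),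
`|Node| ≤ 35 (2 |Atom|)^32`; hence at the window size `n = ⌊log₂ m⌋`, `r + n = m`, the number of gates is
bounded by an explicit POLYNOMIAL in `m` (`WCan.card_Node_le_eval`: `2^{c ⌊log₂ m⌋} ≤ m^c`).  The exponent is
absurd (a consequence of the uniform parameter records and the width-8/width-4 formula layers, which index
many duplicate and idle gates) and irrelevant: the thesis asks for polynomial size.
-/

-- `Summit.PneNP.PneNP.…` duplicates `PneNP` BY DESIGN (single-problem summit, D-0017 layout).
set_option linter.dupNamespace false

namespace Summit.PneNP.PneNP.Theorems

namespace WCan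

open Finset Polynomial

variable {K r n : ℕ}

/-! ### Records -/

/-- A product of numbers each at most `M` is at most `M ^ length`. -/
theorem list_prod_le_pow {l : List ℕ} {M : ℕ} (h : ∀ x ∈ l, x ≤ M) : l.prod ≤ M ^ l.length := by
  induction l with
  | nil => simp
  | cons a l ih =>
    rw [List.prod_cons, List.length_cons, pow_succ, mul_comm (M ^ _)]
    exact Nat.mul_le_mul (h a (by simp)) (ih fun x hx => h x (by simp [hx]))

/-- The size parameter `s = r + n + 2` dominates all the small index ranges. -/
theorem small_le (r n : ℕ) :
    T n + 1 ≤ 4 * (r + n + 2) ^ 5 ∧ n + 1 ≤ 4 * (r + n + 2) ^ 5 ∧ n ^ 5 ≤ 4 * (r + n + 2) ^ 5 ∧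
    n ^ 3 ≤ 4 * (r + n + 2) ^ 5 ∧ r + 1 ≤ 4 * (r + n + 2) ^ 5 ∧ 2 ≤ 4 * (r + n + 2) ^ 5 ∧
    NB r n + 1 ≤ 4 * (r + n + 2) ^ 5 ∧ NBp r n + 1 ≤ 4 * (r + n + 2) ^ 5 := by
  set s := r + n + 2 with hs
  have h1 : 1 ≤ s := by omega
  have hn : n ≤ s := by omega
  have hr : r ≤ s := by omega
  have hs2 : s ≤ s ^ 5 := by
    calc s = s ^ 1 := (pow_one s).symm
      _ ≤ s ^ 5 := Nat.pow_le_pow_right h1 (by norm_num)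
  have hn5 : n ^ 5 ≤ s ^ 5 := Nat.pow_le_pow_left hn 5
  have hn3 : n ^ 3 ≤ s ^ 5 := (Nat.pow_le_pow_left hn 3).trans (Nat.pow_le_pow_right h1 (by norm_num))
  have hsq : s * s ≤ s ^ 5 := by
    calc s * s = s ^ 2 := (sq s).symm
      _ ≤ s ^ 5 := Nat.pow_le_pow_right h1 (by norm_num)
  have hslt : s * s < s ^ 5 := by
    calc s * s = s ^ 2 := (sq s).symm
      _ < s ^ 5 := Nat.pow_lt_pow_right (by omega) (by norm_num)
  have hNB : NB r n + 1 ≤ 3 * s ^ 5 := by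
    unfold NB
    have : n * n ≤ s * s := Nat.mul_le_mul hn hn
    have : n * r ≤ s * s := Nat.mul_le_mul hn hr
    omega
  simp only [T, NBp]
  omega

/-- **`|Prm r n| ≤ 2^n · (4 (r+n+2)^5)^12`.** -/
theorem card_Prm_le (r n : ℕ) : Fintype.card (Prm r n) ≤ 2 ^ n * (4 * (r + n + 2) ^ 5) ^ 12 := by
  obtain ⟨h1, h2, h3, h4, h5, h6, h7, h8⟩ := small_le r n
  rw [Fintype.card_congr Prm.equivTuple]
  have hcard : Fintype.card (Prm.Tuple r n) = 2 ^ n * [T n + 1, n + 1, n + 1, n ^ 5, n ^ 3, n + 1, n + 1, r + 1,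
      r + 1, 2, NB r n + 1, NBp r n + 1].prod := by
    simp only [Prm.Tuple, Fintype.card_prod, Fintype.card_fin, Fintype.card_fun, Fintype.card_option,
      Fintype.card_finset, Fintype.card_bool, List.prod_cons, List.prod_nil]
    ring
  rw [hcard]
  refine Nat.mul_le_mul_left _ ?_
  refine (list_prod_le_pow (M := 4 * (r + n + 2) ^ 5) ?_).trans_eq (by simp)
  intro x hx
  simp only [List.mem_cons, List.not_mem_nil, or_false] at hx
  rcases hx with rfl | rfl | rfl | rfl | rfl | rfl | rfl | rfl | rfl | rfl | rfl | rfl <;> assumption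

/-! ### Atoms -/

/-- There are `6` shared families. -/
theorem card_SKind : Fintype.card SKind = 6 := rfl

/-- There are `54` labelled families. -/
theorem card_Kind : Fintype.card Kind = 54 := rfl

/-- Exact count of the atoms through a surjection from a sum type. -/
theorem card_Atom_le_sum (K r n : ℕ) : Fintype.card (Atom K r n) ≤
    2 + r * r + NB r n + 6 * Fintype.card (Prm r n) + Fintype.card (Lab K n) * (54 * Fintype.card (Prm r n)) := by
  classical
  let S := Fin 2 ⊕ (Fin r × Fin r) ⊕ Fin (NB r n) ⊕ (SKind × Prm r n) ⊕ (Lab K n × Kind × Prm r n)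
  let ψ : S → Atom K r n := fun s => match s with
    | .inl i => if (i : ℕ) = 0 then .tt else .ff
    | .inr (.inl ⟨o, o'⟩) => .oo o o'
    | .inr (.inr (.inl b)) => .outv b
    | .inr (.inr (.inr (.inl ⟨k, P⟩))) => .sh k P
    | .inr (.inr (.inr (.inr ⟨L, k, P⟩))) => .lab L k P
  have hψ : Function.Surjective ψ := by
    intro a
    cases a with
    | tt => exact ⟨.inl 0, rfl⟩
    | ff => exact ⟨.inl 1, rfl⟩
    | oo o o' => exact ⟨.inr (.inl ⟨o, o'⟩), rfl⟩
    | outv b => exact ⟨.inr (.inr (.inl b)), rfl⟩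
    | sh k P => exact ⟨.inr (.inr (.inr (.inl ⟨k, P⟩))), rfl⟩
    | lab L k P => exact ⟨.inr (.inr (.inr (.inr ⟨L, k, P⟩))), rfl⟩
  have := Fintype.card_le_of_surjective ψ hψ
  simp only [S, Fintype.card_sum, Fintype.card_prod, Fintype.card_fin, card_SKind, card_Kind, Lab.card_eq] at this
  rw [Lab.card_eq]
  omega

/-- The crude atom bound. -/
def A0 (K r n : ℕ) : ℕ := 64 * 2 ^ ((2 * K + 4) * n) * (4 * (r + n + 2) ^ 5) ^ 12

/-- The arithmetic of the atom bound, on abstract quantities. -/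
theorem atom_arith {A rr nb P Lb E F S : ℕ} (hA : A ≤ 2 + rr + nb + 6 * P + Lb * (54 * P)) (hP : P ≤ F * S)
    (hL : Lb ≤ E) (hsmall : 2 + rr + nb ≤ 4 * S) (hE : 1 ≤ E) (hF : 1 ≤ F) : A ≤ 64 * (E * F) * S := by
  have h1 : S ≤ E * F * S := by
    calc S = 1 * 1 * S := by ring
      _ ≤ E * F * S := by gcongr
  have h2 : P ≤ E * F * S := by
    calc P ≤ F * S := hP
      _ = 1 * F * S := by ring
      _ ≤ E * F * S := by gcongr
  have h3 : Lb * (54 * P) ≤ 54 * (E * F * S) := by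
    calc Lb * (54 * P) = 54 * (Lb * P) := by ring
      _ ≤ 54 * (E * (F * S)) := Nat.mul_le_mul_left _ (Nat.mul_le_mul hL hP)
      _ = 54 * (E * F * S) := by ring
  calc A ≤ 2 + rr + nb + 6 * P + Lb * (54 * P) := hA
    _ ≤ 4 * (E * F * S) + 6 * (E * F * S) + 54 * (E * F * S) := by omega
    _ = 64 * (E * F) * S := by ring

/-- **`|Atom K r n| ≤ A0 K r n = 64 · 2^{(2K+4) n} · (4 (r+n+2)^5)^12`.** -/
theorem card_Atom_le (K r n : ℕ) : Fintype.card (Atom K r n) ≤ A0 K r n := by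
  obtain ⟨-, -, -, -, h5, h6, h7, -⟩ := small_le r n
  set s5 := 4 * (r + n + 2) ^ 5 with hs5
  have hs1 : 1 ≤ s5 := by omega
  have hsmall : 2 + r * r + NB r n ≤ 4 * s5 ^ 12 := by
    have hrr : r * r ≤ s5 * s5 := Nat.mul_le_mul (by omega) (by omega)
    have h2 : s5 * s5 ≤ s5 ^ 12 := by
      calc s5 * s5 = s5 ^ 2 := (sq _).symm
        _ ≤ s5 ^ 12 := Nat.pow_le_pow_right hs1 (by norm_num)
    have h3 : s5 ≤ s5 ^ 12 := by
      calc s5 = s5 ^ 1 := (pow_one _).symm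
        _ ≤ s5 ^ 12 := Nat.pow_le_pow_right hs1 (by norm_num)
    omega
  have hE : 2 ^ ((2 * K + 4) * n) = 2 ^ ((2 * K + 3) * n) * 2 ^ n := by rw [← pow_add]; ring_nf
  have := atom_arith (card_Atom_le_sum K r n) (card_Prm_le r n) (card_Lab_le K n) hsmall Nat.one_le_two_pow
    Nat.one_le_two_pow
  unfold A0
  rw [hE]
  exact this

/-! ### Gates -/

/-- `|N1| ≤ 2 · (2 |Atom|)^8`. -/
theorem card_N1_le (K r n : ℕ) : Fintype.card (N1 K r n) ≤ 2 * (2 * Fintype.card (Atom K r n)) ^ 8 := by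
  classical
  have := Fintype.card_le_of_surjective (fun p : Bool × (Fin 8 → Lit K r n) => (⟨p.1, p.2⟩ : N1 K r n))
    (fun f => ⟨(f.isAnd, f.ls), rfl⟩)
  simpa [Fintype.card_prod, Fintype.card_bool, Fintype.card_fun, Lit, mul_comm] using this

/-- `|N2| ≤ 2 · |N1|^4`. -/
theorem card_N2_le (K r n : ℕ) : Fintype.card (N2 K r n) ≤ 2 * Fintype.card (N1 K r n) ^ 4 := by
  classical
  have := Fintype.card_le_of_surjective (fun p : Bool × (Fin 4 → N1 K r n) => (⟨p.1, p.2⟩ : N2 K r n))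
    (fun f => ⟨(f.isAnd, f.xs), rfl⟩)
  simpa [Fintype.card_prod, Fintype.card_bool, Fintype.card_fun] using this

/-- **`|Node K r n| ≤ 35 · (2 |Atom K r n| + 2)^32`.** -/
theorem card_Node_le_atom (K r n : ℕ) : Fintype.card (Node K r n) ≤ 35 * (2 * Fintype.card (Atom K r n) + 2) ^ 32 := by
  classical
  set A := Fintype.card (Atom K r n)
  have hsurj := Fintype.card_le_of_surjective
    (fun s : Atom K r n ⊕ Atom K r n ⊕ N1 K r n ⊕ N2 K r n => match s with
      | .inl a => Node.atom a | .inr (.inl a) => Node.natom a | .inr (.inr (.inl f)) => Node.f1 f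
      | .inr (.inr (.inr f)) => Node.f2 f)
    (fun l => by
      cases l with
      | atom a => exact ⟨.inl a, rfl⟩
      | natom a => exact ⟨.inr (.inl a), rfl⟩
      | f1 f => exact ⟨.inr (.inr (.inl f)), rfl⟩
      | f2 f => exact ⟨.inr (.inr (.inr f)), rfl⟩)
  simp only [Fintype.card_sum] at hsurj
  have h1 := card_N1_le K r n
  have h2 := card_N2_le K r n
  set B := 2 * A + 2 with hB
  have hB1 : 1 ≤ B := by omega
  have hA : A + A ≤ B ^ 32 := by
    calc A + A ≤ B := by omega
      _ = B ^ 1 := (pow_one B).symm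
      _ ≤ B ^ 32 := Nat.pow_le_pow_right hB1 (by norm_num)
  have hN1 : Fintype.card (N1 K r n) ≤ 2 * B ^ 8 :=
    h1.trans (Nat.mul_le_mul_left _ (Nat.pow_le_pow_left (by omega) 8))
  have hN1' : 2 * B ^ 8 ≤ 2 * B ^ 32 := Nat.mul_le_mul_left _ (Nat.pow_le_pow_right hB1 (by norm_num))
  have hN2 : Fintype.card (N2 K r n) ≤ 32 * B ^ 32 := by
    calc Fintype.card (N2 K r n) ≤ 2 * Fintype.card (N1 K r n) ^ 4 := h2
      _ ≤ 2 * (2 * B ^ 8) ^ 4 := Nat.mul_le_mul_left _ (Nat.pow_le_pow_left hN1 4)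
      _ = 32 * B ^ 32 := by ring
  omega

/-! ### At the window size: a polynomial in `m` -/

/-- `2 ^ (c · ⌊log₂ m⌋) ≤ (m+1)^c`. -/
theorem two_pow_mul_log_le (c m : ℕ) : 2 ^ (c * Nat.log 2 m) ≤ (m + 1) ^ c := by
  rw [mul_comm, pow_mul]
  refine Nat.pow_le_pow_left ?_ c
  rcases Nat.eq_zero_or_pos m with rfl | hm
  · simp
  · exact (Nat.pow_log_le_self 2 hm.ne').trans (Nat.le_succ m)

/-- THE SIZE POLYNOMIAL (for disorder constant `K`). -/
noncomputable def sizePoly (K : ℕ) : Polynomial ℕ :=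
  C (35 * 2 ^ 32) * (C 64 * (X + 1) ^ (2 * K + 4) * (C 4 * (X + 2) ^ 5) ^ 12 + 1) ^ 32

/-- **At window size `n` with `r + n = m` and `n ≤ ⌊log₂ m⌋`, the gate type has at most `sizePoly K (m)` elements.** -/
theorem card_Node_le_eval (K r n m : ℕ) (hm : r + n = m) (hn : n ≤ Nat.log 2 m) :
    Fintype.card (Node K r n) ≤ (sizePoly K).eval m := by
  have h1 := card_Node_le_atom K r n
  have h2 := card_Atom_le K r n
  have hlog : 2 ^ ((2 * K + 4) * n) ≤ (m + 1) ^ (2 * K + 4) :=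
    (Nat.pow_le_pow_right two_pos (Nat.mul_le_mul_left _ hn)).trans (two_pow_mul_log_le _ _)
  have hA0 : A0 K r n ≤ 64 * (m + 1) ^ (2 * K + 4) * (4 * (m + 2) ^ 5) ^ 12 := by
    unfold A0; rw [hm]; gcongr
  have heval : (sizePoly K).eval m = 35 * 2 ^ 32 * (64 * (m + 1) ^ (2 * K + 4) * (4 * (m + 2) ^ 5) ^ 12 + 1) ^ 32 := by
    simp [sizePoly, eval_add, eval_mul, eval_pow, eval_X]
  rw [heval]
  calc Fintype.card (Node K r n) ≤ 35 * (2 * Fintype.card (Atom K r n) + 2) ^ 32 := h1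
    _ ≤ 35 * (2 * A0 K r n + 2) ^ 32 := by gcongr
    _ = 35 * (2 ^ 32 * (A0 K r n + 1) ^ 32) := by rw [← mul_pow]; ring
    _ = 35 * 2 ^ 32 * (A0 K r n + 1) ^ 32 := by ring
    _ ≤ 35 * 2 ^ 32 * (64 * (m + 1) ^ (2 * K + 4) * (4 * (m + 2) ^ 5) ^ 12 + 1) ^ 32 := by gcongr

end WCan

end Summit.PneNP.PneNP.Theorems
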